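import Summits.CriticalPhenomena.Ising3DConformalLimit.Theorems.InverseSquareTelemetryTwoPointSpineComplementHalfEdge
import Summits.CriticalPhenomena.Ising3DConformalLimit.Theorems.PerfectScreeningNonSaturation
import Summits.CriticalPhenomena.Ising3DConformalLimit.Theorems.CoulombImpliesNontrivial.Negative.Antecedent
import Literature.Probability.LatticeModels.CriticalEtaUpperDCPProofs
import HarnessLib

/-!
# Crux `InverseSquareTelemetry.TwoPointSpineComplement` (stmt-CriticalPhenomena-4497), lead c3: interaction screens —
# `(C)` (with the law), the conjunct itself, and items 4738 ∧ 0636 each imply `η(3) > 0` (`EtaPositive`, `NonSaturation`)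

THEOREM-ONLY helper file (`--supports stmt-CriticalPhenomena-4497`; no definition, no named fact, no `sorry`), sequel of
`…HalfEdge.lean` (p149757: a non-degenerate scale-covariant pointwise limit of `criticalCorr 3` with `U₄ ≢ 0` has `Δ > 1/2`,
via the proved cruxes stmt-8367 / 1980 / 1979). Since dilations of a full-filter limit are automatic
(`exists_scaleCovariant_normalised`: the normalisation of ANY non-degenerate pointwise limit is scale covariant with some
`Δ' ∈ [1/2, 1]`), the window theorem `dimension_window_and_eta` then yields the logarithmic exponent `η = 2Δ' − 1 > 0`, and
with it pointwise decay. Kernel-checked here: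

* `etaPositive_of_hasIsingExponentEta` — a positive logarithmic `η` gives the pointwise bound of item stmt-2600
  `AnomalousForcesInteraction.EtaPositive` (`G ≤ C‖x‖^{-(1+η/2)}`; `HasSpatialDecayExponent.exists_le_mul_rpow`).
* `etaPositive_of_limit_of_hasNontrivialU4`, `screened_of_limit_of_hasNontrivialU4` — ONE non-degenerate pointwise limit of
  `criticalCorr 3` with `U₄ ≢ 0` forces `EtaPositive`, hence perfect screening `‖x‖⟨σ₀σ_x⟩ → 0` and `NonSaturation`.
* item-level edges: `etaPositive_of_limitExists_of_nonGaussian` (**4738 ∧ 0636 ⟹ 2600**),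
  `nonSaturation_of_limitExists_of_nonGaussian` (4738 ∧ 0636 ⟹ 1342),
  `coulombImpliesNontrivial_iff_nonSaturation_of_limitExists` (**under 4738, crux 13885 ⟺ item 1342**),
  `etaPositive_of_critIsing3DConformalLimit` (**the summit conjunct ⟹ 2600**);
* crux-level: `etaPositive_of_twoPointSpineComplement` (registered bookkeeping stub; header on one line: **(C) ⟹ 0634 ⟹ 2600**),
  `nonSaturation_of_twoPointSpineComplement`, `screened_of_twoPointSpineComplement` — sharpening `HalfEdge.noCoulombLaw_of_…`.

So on the ledger: the non-Gaussianity crux 0636 together with bare existence 4738 already PAYS the `η > 0` items 2600 / 1342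
(and the reshaped corner stub α″ of this crux), not conversely.

References: Duminil-Copin–Panis, CMP 406 (2025) Thm 1.5; Fisher, Phys. Rev. 180 (1969) 594 (η ≥ 0); Pohlmeyer, CMP 12 (1969).
-/

noncomputable section

namespace Summit.CriticalPhenomena.Ising3DConformalLimit.InverseSquareTelemetryTwoPointSpineComplement.Screening

open Literature.Probability.LatticeModels Filter Topology
open Summit.CriticalPhenomena.Ising3DConformalLimit.Theses
open Summit.CriticalPhenomena.Ising3DConformalLimit.Theses.InverseSquareTelemetry
  (TwoPointSpineComplement IsingEuclidUpgradeR2RotInvPowerLaw)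
open Summit.CriticalPhenomena.Ising3DConformalLimit.Theses.PrecisionLaplacian (IsingEuclidUpgradeR4NonGaussian)
open Summit.CriticalPhenomena.Ising3DConformalLimit.MoebiusLimitExistsNegative
  (normalised_hasLimit normalised_nondeg hasNontrivialU4_normalised_iff exists_scaleCovariant_normalised)
open Summit.CriticalPhenomena.Ising3DConformalLimit.GaussianLimitNotScreenedNegative
  (dimension_window_and_eta screened_of_half_lt)
open Summit.CriticalPhenomena.Ising3DConformalLimit.InverseSquareTelemetryTwoPointSpineComplement.HalfEdge
  (half_lt_of_hasNontrivialU4)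
open Summit.CriticalPhenomena.Ising3DConformalLimit.CoulombImpliesNontrivialNegative
  (coulombImpliesNontrivial_iff_nonSaturation_or)

/-! ### A positive logarithmic `η` gives the pointwise bound `EtaPositive` -/

/-- **`η > 0` (logarithmic sense) ⟹ `EtaPositive`.** If `log⟨σ₀σ_x⟩/log‖x‖ → −(1+η)` cofinitely on `ℤ³` with `η > 0`, then
`⟨σ₀σ_x⟩ ≤ C‖x‖^{-(1+η/2)}` for all `x ≠ 0` (`HasSpatialDecayExponent.exists_le_mul_rpow` with `ε = η/2`), which is
item stmt-2600 with `κ = η/2`. [cite: DuminilCopinPanis2025LowerBounds, eq. (1.3) and proof of Theorem 1.5] -/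
theorem etaPositive_of_hasIsingExponentEta {η : ℝ} (hη : 0 < η) (h : HasIsingExponentEta 3 η) :
    AnomalousForcesInteraction.EtaPositive := by
  have h' : HasSpatialDecayExponent (criticalTwoPoint 3) (((3 : ℕ) : ℝ) - 2 + η) := h
  obtain ⟨K, -, hK⟩ := h'.exists_le_mul_rpow (half_pos hη)
  refine ⟨η / 2, K, half_pos hη, fun x hx => ?_⟩
  have he : (-(((3 : ℕ) : ℝ) - 2 + η) + η / 2) = -(1 + η / 2) := by push_cast; ring
  simpa only [he] using hK x hx

/-! ### One interacting limit screens -/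

section OneLimit

variable {ρ : ℝ → ℝ} {S : CorrFamily 3}

/-- **One non-degenerate pointwise limit with `U₄ ≢ 0` gives a positive logarithmic `η ≤ 1/2`.** Normalise `S`; it is
scale covariant with some `Δ'` (`exists_scaleCovariant_normalised`); `Δ' > 1/2` by `HalfEdge.half_lt_of_hasNontrivialU4`;
`dimension_window_and_eta` gives `Δ' ≤ 3/4` and the exponent `η = 2Δ' − 1`. [cite: DuminilCopinPanis2025LowerBounds, Theorem 1.5] -/
theorem etaExponent_pos_of_limit_of_hasNontrivialU4 (hρ : ∀ δ ∈ Set.Ioc (0:ℝ) 1, 0 < ρ δ)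
    (hlim : HasPointwiseScalingLimit (criticalCorr 3) ρ S) (hnd : IsNondegenerateTwoPoint S)
    (hU : HasNontrivialU4 S) : ∃ η : ℝ, 0 < η ∧ η ≤ 1 / 2 ∧ HasIsingExponentEta 3 η := by
  classical
  obtain ⟨Δ', -, hsc'⟩ := exists_scaleCovariant_normalised hρ hlim hnd
  have hlim' := normalised_hasLimit hlim
  have hnd' := normalised_nondeg hnd
  have hU' : HasNontrivialU4 (fun n x => if x ∈ NonCoincident 3 n then S n x else 0) :=
    hasNontrivialU4_normalised_iff.2 hU
  have hΔ : 1 / 2 < Δ' := half_lt_of_hasNontrivialU4 hρ hlim' hnd' hsc' hU'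
  obtain ⟨⟨-, h₂⟩, hη⟩ := dimension_window_and_eta hρ hlim' hnd' hsc'
  exact ⟨2 * Δ' - 1, by linarith, by linarith, hη⟩

/-- **One interacting limit gives `EtaPositive`** (item stmt-2600). [folklore] -/
theorem etaPositive_of_limit_of_hasNontrivialU4 (hρ : ∀ δ ∈ Set.Ioc (0:ℝ) 1, 0 < ρ δ)
    (hlim : HasPointwiseScalingLimit (criticalCorr 3) ρ S) (hnd : IsNondegenerateTwoPoint S)
    (hU : HasNontrivialU4 S) : AnomalousForcesInteraction.EtaPositive := by
  obtain ⟨η, hη, -, h⟩ := etaExponent_pos_of_limit_of_hasNontrivialU4 hρ hlim hnd hU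
  exact etaPositive_of_hasIsingExponentEta hη h

/-- **One interacting limit screens the infrared bound**: `‖x‖·⟨σ₀σ_x⟩⁺_{β_c(3)} → 0` cofinitely. [folklore] -/
theorem screened_of_limit_of_hasNontrivialU4 (hρ : ∀ δ ∈ Set.Ioc (0:ℝ) 1, 0 < ρ δ)
    (hlim : HasPointwiseScalingLimit (criticalCorr 3) ρ S) (hnd : IsNondegenerateTwoPoint S)
    (hU : HasNontrivialU4 S) : Tendsto (fun x : Site 3 => ‖x‖ * criticalTwoPoint 3 x) cofinite (𝓝 0) := by
  classical
  obtain ⟨Δ', -, hsc'⟩ := exists_scaleCovariant_normalised hρ hlim hnd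
  have hlim' := normalised_hasLimit hlim
  have hnd' := normalised_nondeg hnd
  have hU' : HasNontrivialU4 (fun n x => if x ∈ NonCoincident 3 n then S n x else 0) :=
    hasNontrivialU4_normalised_iff.2 hU
  exact screened_of_half_lt hρ hlim' hnd' hsc' (half_lt_of_hasNontrivialU4 hρ hlim' hnd' hsc' hU')

/-- **One interacting limit gives `NonSaturation`** (item stmt-1342). [folklore] -/
theorem nonSaturation_of_limit_of_hasNontrivialU4 (hρ : ∀ δ ∈ Set.Ioc (0:ℝ) 1, 0 < ρ δ)
    (hlim : HasPointwiseScalingLimit (criticalCorr 3) ρ S) (hnd : IsNondegenerateTwoPoint S)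
    (hU : HasNontrivialU4 S) : PerfectScreening.NonSaturation :=
  Theorems.nonSaturation_of_tendsto_norm_mul (screened_of_limit_of_hasNontrivialU4 hρ hlim hnd hU)

end OneLimit

/-! ### Item-level edges: existence + non-Gaussianity pay the `η > 0` items -/

/-- **Items 4738 ∧ 0636 ⟹ item 2600 (`EtaPositive`).** [folklore] -/
theorem etaPositive_of_limitExists_of_nonGaussian (hL : WeylWindow.LimitExists) (hN : IsingEuclidUpgradeR4NonGaussian) :
    AnomalousForcesInteraction.EtaPositive := by
  obtain ⟨ρ, S, hρ, hlim, hnd⟩ := hL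
  exact etaPositive_of_limit_of_hasNontrivialU4 hρ hlim hnd (hN ρ S hρ hlim hnd)

/-- **Items 4738 ∧ 0636 ⟹ item 1342 (`NonSaturation`).** [folklore] -/
theorem nonSaturation_of_limitExists_of_nonGaussian (hL : WeylWindow.LimitExists)
    (hN : IsingEuclidUpgradeR4NonGaussian) : PerfectScreening.NonSaturation := by
  obtain ⟨ρ, S, hρ, hlim, hnd⟩ := hL
  exact nonSaturation_of_limit_of_hasNontrivialU4 hρ hlim hnd (hN ρ S hρ hlim hnd)

/-- **Under item 4738, crux 13885 `CoulombImpliesNontrivial` is EQUIVALENT to item 1342 `NonSaturation`**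
(`13885 ↔ 1342 ∨ 0636`, landed, and `4738 ∧ 0636 ⟹ 1342`). [folklore] -/
theorem coulombImpliesNontrivial_iff_nonSaturation_of_limitExists (hL : WeylWindow.LimitExists) :
    PerfectScreening.CoulombImpliesNontrivial ↔ PerfectScreening.NonSaturation := by
  rw [coulombImpliesNontrivial_iff_nonSaturation_or]
  constructor
  · rintro (h | h)
    · exact h
    · exact nonSaturation_of_limitExists_of_nonGaussian hL h
  · exact Or.inl

/-- **The summit conjunct ⟹ item 2600**: `CritIsing3DConformalLimit` (a non-degenerate Möbius-covariant pointwise limit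
with `U₄ ≢ 0`) forces `⟨σ₀σ_x⟩⁺_{β_c(3)} ≤ C‖x‖^{-(1+κ)}` with `κ > 0`. [folklore] -/
theorem etaPositive_of_critIsing3DConformalLimit (h : CritIsing3DConformalLimit) :
    AnomalousForcesInteraction.EtaPositive := by
  obtain ⟨ρ, -, S, hρ, -, hlim, hnd, -, hU⟩ := h
  exact etaPositive_of_limit_of_hasNontrivialU4 hρ hlim hnd hU

/-! ### Crux-level: `(C)` with the law pays the `η > 0` items -/

/-- **(C) ⟹ item 0634 ⟹ item 2600 (registered bookkeeping stub of this `--supports` file; header on one line).** Under the crux and a witness of the two-point law, the crux's own witness is an interacting non-degenerate limit, so `EtaPositive` holds (`etaPositive_of_limit_of_hasNontrivialU4`). [folklore] -/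
theorem etaPositive_of_twoPointSpineComplement : Summit.CriticalPhenomena.Ising3DConformalLimit.Theses.InverseSquareTelemetry.TwoPointSpineComplement → Summit.CriticalPhenomena.Ising3DConformalLimit.Theses.InverseSquareTelemetry.IsingEuclidUpgradeR2RotInvPowerLaw → Summit.CriticalPhenomena.Ising3DConformalLimit.Theses.AnomalousForcesInteraction.EtaPositive := by
  rintro h ⟨Δ, c, hc, hP⟩
  obtain ⟨ρ, S, hρ, -, hlim, hnd, -, hU⟩ := h Δ c hc hP
  exact etaPositive_of_limit_of_hasNontrivialU4 hρ hlim hnd hU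

/-- **(C) screens**: under the crux, every witness `(Δ, c)` of the law comes with `‖x‖·⟨σ₀σ_x⟩ → 0`. [folklore] -/
theorem screened_of_twoPointSpineComplement (h : TwoPointSpineComplement) {Δ c : ℝ} (hc : 0 < c)
    (hP : Tendsto (fun x : Site 3 =>
      criticalTwoPoint 3 x * Real.sqrt (∑ i, ((x i : ℝ)) ^ 2) ^ (2 * Δ)) cofinite (nhds c)) :
    Tendsto (fun x : Site 3 => ‖x‖ * criticalTwoPoint 3 x) cofinite (𝓝 0) := by
  obtain ⟨ρ, S, hρ, -, hlim, hnd, -, hU⟩ := h Δ c hc hP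
  exact screened_of_limit_of_hasNontrivialU4 hρ hlim hnd hU

/-- **(C) ⟹ item 0634 ⟹ item 1342** (sharpening `HalfEdge.noCoulombLaw_of_twoPointSpineComplement`). [folklore] -/
theorem nonSaturation_of_twoPointSpineComplement (h : TwoPointSpineComplement) (hP : IsingEuclidUpgradeR2RotInvPowerLaw) :
    PerfectScreening.NonSaturation := by
  obtain ⟨Δ, c, hc, hPc⟩ := hP
  exact Theorems.nonSaturation_of_tendsto_norm_mul (screened_of_twoPointSpineComplement h hc hPc)

end Summit.CriticalPhenomena.Ising3DConformalLimit.InverseSquareTelemetryTwoPointSpineComplement.Screening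

end
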